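import Mathlib
import HarnessLib
import Summits.NavierStokesRegularity.NavierStokesRegularity.Theorems.PoloidalWindowDoorLrcModEntireJetCertGauge

/-!
# Jet-certificate checker — the SEMI-ALGEBRAIC (Positivstellensatz) LEAF: sign constraints at the base point, sums of squares,
# point-level («truncation-level») emptiness, tables of rows, and the rational-witness check

Cell pub-ns-dss, seat ns-crc-p1 gen 5, re-keyed as Lean-certificate hand of the wall experiment `ns-wall-extremal` (DIRECTOR-NS dss_99 (2) /
req171 (3); arm C: truncated poloidal / ONE-SIGNED ancient-profile exclusion tables), 2026-08-28.  `--supports stmt-NavierStokesRegularity-19708`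
(wall W4 `PoloidalWindowRigidity`; serves equally wall W3, crux 26991 `TiltDominationLoc` ⟺ `OneSignedRigidity`, whose class hypothesis
`⟪curl v, e₃⟫ ≥ 0` is an INEQUALITY).  Generic differential/real algebra; no Navier–Stokes content.

THE GAP THIS FILLS.  The tree's exact-elimination checker (`…JetCertDefs/Masked/Tree/Fast/Fast2/Gauge/Relabel`, K2 lineage, item 20428) refutes a
`LocalDatumZ` — hypothesis laws `= 0` on an open set, pins `≠ 0` and gauge letters `= 0` at the base point — by an IDEAL-MEMBERSHIP leaf
(`pins^e ∈ ⟨laws⟩ + ⟨gauge letters⟩`, Boolean `leafCheckZ`).  A one-signed class adds hypotheses of a third kind: polynomial INEQUALITIES `q ≥ 0` in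
the jet letters AT THE BASE POINT (e.g. at an interior zero `p₀` of `ω₃ ≥ 0`: `ω₃(p₀) = 0`, `∇ω₃(p₀) = 0` are gauge letters and the principal minors of
the Hessian of `ω₃` are `≥ 0`).  Ideal membership is then the wrong notion of «empty»; the right one is Stengle's Positivstellensatz: the real set
`{laws = 0, q ≥ 0, gauge letters = 0, pins ≠ 0}` is empty iff `pins^(2e) + σ₀ + Σ_j σ_j · Π_{i∈S_j} q_i ∈ ⟨laws⟩ + ⟨gauge letters⟩` for some sums of
squares `σ`.  Such a certificate (SOS with explicit rational weights and explicit squares — e.g. an SDP solution rounded to `ℚ`, or by hand) is checked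
by the same term-list arithmetic as before: ONE Boolean per row, `decide` / `native_decide`.

* `sosExpand`, `subProduct`, `coneExpand`, `idealComb` with their value lemmas (`≥ 0`, `≥ 0`, `≥ 0`, `= 0`); `ev_pinProduct_two_mul_pos` (`pins^(2e) > 0`);
* `trimExp`/`trimQ` (canonical exponent lists: the final comparison is insensitive to trailing zeros, so dense and sparse producers agree);
* `PsatzLeaf` (steps, comb, e, sos0, sosG), `psatzBody`, and the point-level contradiction `false_of_psatzBody`;
* `LocalDatumZP n S M v hyps pins zs nonneg` — a `LocalDatumZ` whose jet point moreover has `q(g p₀) ≥ 0` for `q ∈ nonneg`; `toLocalDatumZ`,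
  `of_localDatumZ`, `extendS` (chunking); the Boolean `leafCheckZP` and **`LocalDatumZP.false_of_leafP`** (soundness of the germ-level leaf);
* POINT LEVEL (= «truncation level N»: the letters are all jets of weight `≤ N`, the laws are the system prolonged to weight `N`, NO differentiation):
  `PointDatum n hyps pins zs nonneg` (a real point of the semi-algebraic set), `LocalDatumZP.pointDatum` (a germ gives a point), the Boolean
  `pointCheckP` and **`not_pointDatum_of_pointCheckP`** — the meaning of an «EMPTY(N)» row;
* Tables of rows (`Row`, `tableCheckP`, `tableCheckP_sound`) and WITNESS rows (`witnessCheck`, `pointDatum_of_witnessCheck`): the companion file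
  `…JetCertPsatzTable`.

WHAT THIS IS NOT: not a claim about Navier–Stokes, not a certificate, not a statement about any wall — the checker's semi-algebraic leaf and its
soundness (bears_on LADDER-NS walls W3/W4 only as an instrument).  References: G. Stengle, *A Nullstellensatz and a Positivstellensatz in semialgebraic
geometry*, Math. Ann. 207 (1974) 87–97, Thm 1; J. Bochnak, M. Coste, M.-F. Roy, *Real Algebraic Geometry* (1998) §4.4; the term-list calculus is the tree's
(`Literature.Analysis.ValidatedNumerics.SparsePolynomialEnclosure`, Moore 1979 §3.4). [folklore]
-/

noncomputable section

-- the summit and its single sub-problem share the name (CONVENTIONS §1), as in every Theorems file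
set_option linter.dupNamespace false

namespace Summit.NavierStokesRegularity.NavierStokesRegularity.Theorems.PoloidalWindowDoorLrcModEntireJetCertPsatz

open _root_.Topology _root_.Filter Set
open Literature.Analysis.ValidatedNumerics Literature.Analysis.ValidatedNumerics.QMvPoly
open Literature.Analysis.Calculus.MvPoly
open Summit.NavierStokesRegularity.NavierStokesRegularity.Theorems.PoloidalWindowDoorLrcModEntireJetCertDefs
open Summit.NavierStokesRegularity.NavierStokesRegularity.Theorems.PoloidalWindowDoorLrcModEntireJetCertTree
open Summit.NavierStokesRegularity.NavierStokesRegularity.Theorems.PoloidalWindowDoorLrcModEntireJetCertFast2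
open Summit.NavierStokesRegularity.NavierStokesRegularity.Theorems.PoloidalWindowDoorLrcModEntireJetCertGauge

variable {E : Type*} [NormedAddCommGroup E] [NormedSpace ℝ E] {n : ℕ}

/-! ### Sums of squares, products of sign constraints, the cone element, the ideal part -/

/-- A weighted sum of squares `Σ wᵢ · qᵢ²` as a term list (weights and squares explicit). [folklore] -/
def sosExpand (σ : List (ℚ × QMvPoly)) : QMvPoly :=
  (σ.map fun wq => QMvPoly.smul wq.1 (QMvPoly.mul wq.2 wq.2)).flatten

/-- All weights of a weighted sum of squares are non-negative (Boolean). [folklore] -/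
def sosWeightsOK (σ : List (ℚ × QMvPoly)) : Bool :=
  σ.all fun wq => decide (0 ≤ wq.1)

/-- A weighted sum of squares with non-negative weights is non-negative at every point. [folklore] -/
theorem ev_sosExpand_nonneg (z : EuclideanSpace ℝ (Fin n)) :
    ∀ σ : List (ℚ × QMvPoly), sosWeightsOK σ = true → 0 ≤ ev n (sosExpand σ) z := by
  intro σ
  induction σ with
  | nil => intro; simp [sosExpand]
  | cons wq σ ih =>
    intro h
    simp only [sosWeightsOK, List.all_cons, Bool.and_eq_true, decide_eq_true_eq] at h
    obtain ⟨hw, hσ⟩ := h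
    have hσ' : sosWeightsOK σ = true := by simpa [sosWeightsOK] using hσ
    have hsplit : sosExpand (wq :: σ) = QMvPoly.smul wq.1 (QMvPoly.mul wq.2 wq.2) ++ sosExpand σ := by
      simp [sosExpand]
    rw [hsplit, ev_append, ev_smul, ev_mul]
    exact add_nonneg (mul_nonneg (by exact_mod_cast hw) (mul_self_nonneg _)) (ih hσ')

/-- The product `Π_{i ∈ is} gᵢ` of the sign constraints with the listed indices (an out-of-range index reads the zero polynomial). [folklore] -/
def subProduct (gs : List QMvPoly) : List ℕ → QMvPoly
  | [] => QMvPoly.const 1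
  | i :: is => QMvPoly.mul (gs.getD i []) (subProduct gs is)

/-- A product of quantities that are non-negative at a point is non-negative there. [folklore] -/
theorem ev_subProduct_nonneg (z : EuclideanSpace ℝ (Fin n)) (gs : List QMvPoly) (hgs : ∀ q ∈ gs, 0 ≤ ev n q z) :
    ∀ is : List ℕ, 0 ≤ ev n (subProduct gs is) z := by
  intro is
  induction is with
  | nil => simp [subProduct, ev, QMvPoly.toMv_const, toFun_apply]
  | cons i is ih =>
    rw [subProduct, ev_mul]
    refine mul_nonneg ?_ ih
    rw [List.getD_eq_getElem?_getD]
    cases h : gs[i]? with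
    | none => simp
    | some q => simpa using hgs q (List.mem_of_getElem? h)

/-- The CONE ELEMENT `σ₀ + Σ_j σ_j · Π_{i ∈ S_j} gᵢ` of a Positivstellensatz certificate, as a term list. [folklore] -/
def coneExpand (gs : List QMvPoly) (σ₀ : List (ℚ × QMvPoly)) (σs : List (List (ℚ × QMvPoly) × List ℕ)) : QMvPoly :=
  sosExpand σ₀ ++ (σs.map fun s => QMvPoly.mul (sosExpand s.1) (subProduct gs s.2)).flatten

/-- All weights of a cone element are non-negative (Boolean). [folklore] -/
def coneWeightsOK (σ₀ : List (ℚ × QMvPoly)) (σs : List (List (ℚ × QMvPoly) × List ℕ)) : Bool :=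
  sosWeightsOK σ₀ && σs.all fun s => sosWeightsOK s.1

/-- A cone element with non-negative weights is non-negative wherever the sign constraints hold. [folklore] -/
theorem ev_coneExpand_nonneg (z : EuclideanSpace ℝ (Fin n)) (gs : List QMvPoly) (hgs : ∀ q ∈ gs, 0 ≤ ev n q z)
    (σ₀ : List (ℚ × QMvPoly)) (σs : List (List (ℚ × QMvPoly) × List ℕ)) (h : coneWeightsOK σ₀ σs = true) :
    0 ≤ ev n (coneExpand gs σ₀ σs) z := by
  simp only [coneWeightsOK, Bool.and_eq_true, List.all_eq_true] at h
  obtain ⟨h₀, hs⟩ := h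
  rw [coneExpand, ev_append, ev_flatten, List.map_map]
  refine add_nonneg (ev_sosExpand_nonneg z σ₀ h₀) (List.sum_nonneg ?_)
  intro r hr
  obtain ⟨s, hs', rfl⟩ := List.mem_map.1 hr
  simp only [Function.comp, ev_mul]
  exact mul_nonneg (ev_sosExpand_nonneg z s.1 (hs s hs')) (ev_subProduct_nonneg z gs hgs s.2)

/-- The IDEAL PART at the base point: `Σᵢ cᵢ · law_{kᵢ}` with polynomial cofactors (an out-of-range law index reads the zero polynomial). [folklore] -/
def idealComb (laws : List QMvPoly) (comb : List (QMvPoly × ℕ)) : QMvPoly :=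
  (comb.map fun ck => QMvPoly.mul ck.1 (laws.getD ck.2 [])).flatten

/-- The ideal part vanishes wherever all laws vanish. [folklore] -/
theorem ev_idealComb_eq_zero (z : EuclideanSpace ℝ (Fin n)) (laws : List QMvPoly) (hl : ∀ L ∈ laws, ev n L z = 0)
    (comb : List (QMvPoly × ℕ)) : ev n (idealComb laws comb) z = 0 := by
  rw [idealComb, ev_flatten, List.map_map]
  refine List.sum_eq_zero fun r hr => ?_
  obtain ⟨ck, -, rfl⟩ := List.mem_map.1 hr
  have h0 : ev n (laws.getD ck.2 []) z = 0 := by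
    rw [List.getD_eq_getElem?_getD]
    cases h : laws[ck.2]? with
    | none => simp
    | some L => simpa using hl L (List.mem_of_getElem? h)
  simp only [Function.comp, ev_mul, h0, mul_zero]

/-- Canonical exponent list: trailing zeros dropped (`[1,0]`, `[1]` and `[1,0,0]` denote the same monomial; `normalizeS` merges only IDENTICAL lists, so the
final comparison of a certificate is made on trimmed lists — dense and sparse producers then agree). [folklore] -/
def trimExp : List ℕ → List ℕ
  | [] => []
  | a :: m => match trimExp m with
    | [] => if a = 0 then [] else [a]
    | b :: m' => a :: b :: m'

/-- Trimming does not change any exponent. [folklore] -/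
theorem getD_trimExp : ∀ (m : List ℕ) (i : ℕ), (trimExp m).getD i 0 = m.getD i 0 := by
  intro m
  induction m with
  | nil => intro i; rfl
  | cons a m ih =>
    intro i
    rw [trimExp]
    cases h : trimExp m with
    | nil =>
      have hm : ∀ j, m.getD j 0 = 0 := fun j => by rw [← ih j, h]; rfl
      by_cases ha : a = 0
      · subst ha
        cases i with
        | zero => simp
        | succ j => rw [if_pos rfl, List.getD_cons_succ, hm j]; rfl
      · rw [if_neg ha]
        cases i with
        | zero => simp
        | succ j => rw [List.getD_cons_succ, List.getD_cons_succ, hm j]; rfl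
    | cons b m' =>
      cases i with
      | zero => simp
      | succ j => simp only [List.getD_cons_succ]; rw [← ih j, h]

/-- Trimming does not change the exponent (as a finitely supported function). [folklore] -/
theorem mexp_trimExp (m : List ℕ) : QMvPoly.mexp n (trimExp m) = QMvPoly.mexp n m := by
  ext i
  rw [QMvPoly.mexp_apply, QMvPoly.mexp_apply, getD_trimExp]

/-- Trim every exponent list of a term list. [folklore] -/
def trimQ (p : QMvPoly) : QMvPoly := p.map fun t => (trimExp t.1, t.2)

/-- Trimming does not change the polynomial. [folklore] -/
theorem toMv_trimQ (p : QMvPoly) : QMvPoly.toMv ℝ n (trimQ p) = QMvPoly.toMv ℝ n p := by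
  induction p with
  | nil => simp [trimQ]
  | cons t q ih =>
    simp only [trimQ, List.map_cons] at ih ⊢
    rw [QMvPoly.toMv_cons, QMvPoly.toMv_cons, ih, mexp_trimExp]

/-- `ev` is unchanged by trimming. [folklore] -/
theorem ev_trimQ (p : QMvPoly) (z : EuclideanSpace ℝ (Fin n)) : ev n (trimQ p) z = ev n p z := by
  simp [ev, toMv_trimQ]

/-- An EVEN monomial `Πᵢ πᵢ^(2eᵢ)` in pins that are non-zero at a point is STRICTLY POSITIVE there. [folklore] -/
theorem ev_pinProduct_two_mul_pos (z : EuclideanSpace ℝ (Fin n)) :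
    ∀ (pins : List QMvPoly) (es : List ℕ), (∀ π ∈ pins, ev n π z ≠ 0) →
      0 < ev n (pinProduct pins (es.map fun e => 2 * e)) z := by
  intro pins
  induction pins with
  | nil => intro es _; simp [pinProduct, ev, QMvPoly.toMv_const, toFun_apply]
  | cons π ps ih =>
    intro es hne
    cases es with
    | nil => simp [pinProduct, ev, QMvPoly.toMv_const, toFun_apply]
    | cons e es =>
      rw [List.map_cons, pinProduct, ev_mul, ev_powQ]
      exact mul_pos ((even_two_mul e).pow_pos (hne π (by simp))) (ih es fun π' h => hne π' (by simp [h]))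

/-! ### Positivstellensatz leaves and the point-level contradiction -/

/-- **A POSITIVSTELLENSATZ LEAF** (certificate data).  `steps`: derivation steps replayed by `deriveS` from the hypothesis laws (germ level; `[]` at
point level); `comb`: the ideal part `Σ cᵢ · law_{kᵢ}` (law indices: hypotheses first, then derived laws, as everywhere in the checker); `e`: pin
exponents — the checker uses `pins^(2e)`; `sos0`: `σ₀` as weighted squares `(wᵢ, qᵢ)`; `sosG`: the `σ_j` with the index lists `S_j` of the sign
constraints they multiply.  The identity certified is `pins^(2e) + σ₀ + Σ_j σ_j Π_{S_j} q ≡ Σ cᵢ law_{kᵢ}` modulo terms divisible by a gauge letter. [folklore] -/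
structure PsatzLeaf where
  /-- derivation steps (`deriveS` format); `[]` for a point-level certificate -/
  steps : List (List (QMvPoly × ℕ × List ℕ))
  /-- ideal part: (cofactor, law index) -/
  comb : List (QMvPoly × ℕ)
  /-- pin exponents `e` (the body carries `pins^(2e)`) -/
  e : List ℕ
  /-- `σ₀` as a weighted sum of squares -/
  sos0 : List (ℚ × QMvPoly)
  /-- the multipliers `σ_j` (weighted sums of squares) and the index lists `S_j ⊆ nonneg` -/
  sosG : List (List (ℚ × QMvPoly) × List ℕ)

/-- The POSITIVSTELLENSATZ BODY `pins^(2e) + σ₀ + Σ_j σ_j Π_{S_j} q − Σᵢ cᵢ law_{kᵢ}` (a term list; the check asks that it be gauge-divisible). [folklore] -/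
def psatzBody (pins nonneg laws : List QMvPoly) (c : PsatzLeaf) : QMvPoly :=
  pinProduct pins (c.e.map fun e => 2 * e) ++ coneExpand nonneg c.sos0 c.sosG ++ QMvPoly.smul (-1) (idealComb laws c.comb)

/-- **THE SEMI-ALGEBRAIC CONTRADICTION AT ONE POINT.**  If every law of `laws` vanishes at `z`, every pin is non-zero, every gauge letter vanishes
and every sign constraint is `≥ 0` at `z`, then no Positivstellensatz body with non-negative weights is term-wise divisible by the gauge letters:
evaluating the certified identity at `z` gives `pins^(2e)(z) + (≥ 0) = 0` with `pins^(2e)(z) > 0` (the trivial direction of Stengle's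
Positivstellensatz, Math. Ann. 207 (1974), Thm 1). [folklore] -/
theorem false_of_psatzBody {z : EuclideanSpace ℝ (Fin n)} {laws pins nonneg : List QMvPoly} {zs : List ℕ}
    (hl : ∀ L ∈ laws, ev n L z = 0) (hp : ∀ π ∈ pins, ev n π z ≠ 0) (hz : ∀ i ∈ zs, ∀ hi : i < n, z ⟨i, hi⟩ = 0)
    (hq : ∀ q ∈ nonneg, 0 ≤ ev n q z) (c : PsatzLeaf) (hw : coneWeightsOK c.sos0 c.sosG = true)
    (hdiv : allZeroDiv n zs (normalizeS (trimQ (psatzBody pins nonneg laws c))) = true) : False := by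
  have h0 := ev_eq_zero_of_allZeroDiv (z := z) hz _ hdiv
  rw [ev_normalizeS, ev_trimQ, psatzBody, ev_append, ev_append, ev_smul, ev_idealComb_eq_zero z laws hl] at h0
  have hpos := ev_pinProduct_two_mul_pos z pins c.e hp
  have hcone := ev_coneExpand_nonneg z nonneg hq c.sos0 c.sosG hw
  have hsum : ev n (pinProduct pins (c.e.map fun e => 2 * e)) z + ev n (coneExpand nonneg c.sos0 c.sosG) z = 0 := by
    simpa using h0
  linarith

/-! ### Local data with sign constraints at the base point (germ level) -/

/-- **A LOCAL DATUM WITH POINT-ZERO LETTERS AND POINT-SIGN CONSTRAINTS**: an open `U ∋ p₀`, a jet map `g` differentiable on `U` whose tabled letters have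
the derivative tables `S j` along the directions `v j`, every hypothesis law vanishing on `U` along `g`, every pin non-zero at `g p₀`, every gauge
letter of `zs` vanishing at `g p₀` (all as in `…JetCertGauge.LocalDatumZ`) — AND every polynomial of `nonneg` non-negative at `g p₀`. [folklore] -/
def LocalDatumZP (n : ℕ) (S : ℕ → ℕ → QMvPoly) (M : ℕ → ℕ → Bool) (v : ℕ → E) (hyps pins : List QMvPoly) (zs : List ℕ)
    (nonneg : List QMvPoly) : Prop :=
  ∃ (U : Set E) (p₀ : E) (g : E → EuclideanSpace ℝ (Fin n)), IsOpen U ∧ p₀ ∈ U ∧ (∀ x ∈ U, DifferentiableAt ℝ g x) ∧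
    (∀ j, ∀ i : Fin n, M j i = true → ∀ x ∈ U, fderiv ℝ (fun y => g y i) x (v j) = ev n (S j i) (g x)) ∧
    (∀ L ∈ hyps, ∀ x ∈ U, ev n L (g x) = 0) ∧ (∀ π ∈ pins, ev n π (g p₀) ≠ 0) ∧ (∀ i ∈ zs, ∀ hi : i < n, g p₀ ⟨i, hi⟩ = 0) ∧
    (∀ q ∈ nonneg, 0 ≤ ev n q (g p₀))

/-- Forgetting the sign constraints. [folklore] -/
theorem LocalDatumZP.toLocalDatumZ {S : ℕ → ℕ → QMvPoly} {M : ℕ → ℕ → Bool} {v : ℕ → E} {hyps pins : List QMvPoly} {zs : List ℕ}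
    {nonneg : List QMvPoly} (h : LocalDatumZP (E := E) n S M v hyps pins zs nonneg) : LocalDatumZ (E := E) n S M v hyps pins zs := by
  obtain ⟨U, p₀, g, hU, hp₀, hg, hS, hh, hp, hz, _⟩ := h
  exact ⟨U, p₀, g, hU, hp₀, hg, hS, hh, hp, hz⟩

/-- A `LocalDatumZ` is a `LocalDatumZP` with no sign constraints (so every ideal-membership certificate format remains available). [folklore] -/
theorem LocalDatumZP.of_localDatumZ {S : ℕ → ℕ → QMvPoly} {M : ℕ → ℕ → Bool} {v : ℕ → E} {hyps pins : List QMvPoly} {zs : List ℕ}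
    (h : LocalDatumZ (E := E) n S M v hyps pins zs) : LocalDatumZP (E := E) n S M v hyps pins zs [] := by
  obtain ⟨U, p₀, g, hU, hp₀, hg, hS, hh, hp, hz⟩ := h
  exact ⟨U, p₀, g, hU, hp₀, hg, hS, hh, hp, hz, fun q hq => by simp at hq⟩

/-- **CHUNKING** with sign constraints: a certified law (`certCheckS`, `…JetCertFast2`) joins the hypotheses. [folklore] -/
theorem LocalDatumZP.extendS {S : ℕ → ℕ → QMvPoly} {M : ℕ → ℕ → Bool} {v : ℕ → E} {hyps pins : List QMvPoly} {zs : List ℕ}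
    {nonneg : List QMvPoly} (hdat : LocalDatumZP (E := E) n S M v hyps pins zs nonneg) {cert : List (List (QMvPoly × ℕ × List ℕ))}
    {k : ℕ} {T : QMvPoly} (hcheck : certCheckS n S M hyps cert k T = true) :
    LocalDatumZP (E := E) n S M v (hyps ++ [T]) pins zs nonneg := by
  obtain ⟨U, p₀, g, hU, hp₀, hg, hS, hhyps, hpins, hz, hq⟩ := hdat
  refine ⟨U, p₀, g, hU, hp₀, hg, hS, ?_, hpins, hz, hq⟩
  intro L hL x hx
  rcases List.mem_append.1 hL with h | h
  · exact hhyps L h x hx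
  · rw [List.mem_singleton.1 h]; exact ev_eq_zero_of_certCheckS hU hg hS hhyps hcheck x hx

/-- **THE GERM-LEVEL LEAF CHECK** (Boolean): the weights are non-negative, the derivation `c.steps` replays from `hyps`, and the Positivstellensatz body
built on the derived laws is term-wise divisible by the gauge letters `zs`. [folklore] -/
def leafCheckZP (n : ℕ) (S : ℕ → ℕ → QMvPoly) (M : ℕ → ℕ → Bool) (hyps pins : List QMvPoly) (zs : List ℕ) (nonneg : List QMvPoly)
    (c : PsatzLeaf) : Bool :=
  coneWeightsOK c.sos0 c.sosG &&
    match deriveS n S M hyps c.steps with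
    | none => false
    | some laws => allZeroDiv n zs (normalizeS (trimQ (psatzBody pins nonneg laws c)))

/-- **SOUNDNESS OF THE GERM-LEVEL POSITIVSTELLENSATZ LEAF**: a local datum with sign constraints is refuted by a checked leaf. [folklore] -/
theorem LocalDatumZP.false_of_leafP {S : ℕ → ℕ → QMvPoly} {M : ℕ → ℕ → Bool} {v : ℕ → E} {hyps pins : List QMvPoly} {zs : List ℕ}
    {nonneg : List QMvPoly} (hdat : LocalDatumZP (E := E) n S M v hyps pins zs nonneg) {c : PsatzLeaf}
    (hcheck : leafCheckZP n S M hyps pins zs nonneg c = true) : False := by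
  obtain ⟨U, p₀, g, hU, hp₀, hg, hS, hhyps, hpins, hz, hq⟩ := hdat
  simp only [leafCheckZP, Bool.and_eq_true] at hcheck
  obtain ⟨hw, hcheck⟩ := hcheck
  cases hd : deriveS n S M hyps c.steps with
  | none => simp [hd] at hcheck
  | some laws =>
    simp only [hd] at hcheck
    have hlaws : ∀ L ∈ laws, ev n L (g p₀) = 0 := fun L hL =>
      ev_deriveS_eq_zero hU hg hS c.steps hyps hhyps laws hd L hL p₀ hp₀
    exact false_of_psatzBody hlaws hpins hz hq c hw hcheck

/-! ### Point level («truncation level»): no germ, no tables -/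

/-- **A POINT DATUM**: a real point `z ∈ ℝⁿ` of the semi-algebraic set `{hyps = 0, pins ≠ 0, gauge letters = 0, nonneg ≥ 0}`.  This is the object an
«EMPTY at truncation level N» row denies: the letters are ALL jets of weight `≤ N` at one point and `hyps` is the PDE system prolonged to weight `N`
(every equation and every one of its derivatives that closes inside the letter range), read as polynomial equations between independent unknowns. [folklore] -/
def PointDatum (n : ℕ) (hyps pins : List QMvPoly) (zs : List ℕ) (nonneg : List QMvPoly) : Prop :=
  ∃ z : EuclideanSpace ℝ (Fin n), (∀ L ∈ hyps, ev n L z = 0) ∧ (∀ π ∈ pins, ev n π z ≠ 0) ∧ (∀ i ∈ zs, ∀ hi : i < n, z ⟨i, hi⟩ = 0) ∧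
    (∀ q ∈ nonneg, 0 ≤ ev n q z)

/-- A germ-level datum yields a point datum (its jet point at the base point): point-level emptiness is the STRONGER verdict. [folklore] -/
theorem LocalDatumZP.pointDatum {S : ℕ → ℕ → QMvPoly} {M : ℕ → ℕ → Bool} {v : ℕ → E} {hyps pins : List QMvPoly} {zs : List ℕ}
    {nonneg : List QMvPoly} (h : LocalDatumZP (E := E) n S M v hyps pins zs nonneg) : PointDatum n hyps pins zs nonneg := by
  obtain ⟨U, p₀, g, -, hp₀, -, -, hh, hp, hz, hq⟩ := h
  exact ⟨g p₀, fun L hL => hh L hL p₀ hp₀, hp, hz, hq⟩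

/-- **THE POINT-LEVEL CHECK** (Boolean): non-negative weights and a gauge-divisible Positivstellensatz body built on the hypothesis laws themselves
(`c.steps` is ignored — nothing is differentiated). [folklore] -/
def pointCheckP (n : ℕ) (hyps pins : List QMvPoly) (zs : List ℕ) (nonneg : List QMvPoly) (c : PsatzLeaf) : Bool :=
  coneWeightsOK c.sos0 c.sosG && allZeroDiv n zs (normalizeS (trimQ (psatzBody pins nonneg hyps c)))

/-- **SOUNDNESS AT POINT LEVEL**: a checked point-level certificate proves that the semi-algebraic set has no real point. [folklore] -/
theorem not_pointDatum_of_pointCheckP {hyps pins : List QMvPoly} {zs : List ℕ} {nonneg : List QMvPoly} {c : PsatzLeaf}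
    (hcheck : pointCheckP n hyps pins zs nonneg c = true) : ¬ PointDatum n hyps pins zs nonneg := by
  rintro ⟨z, hh, hp, hz, hq⟩
  simp only [pointCheckP, Bool.and_eq_true] at hcheck
  exact false_of_psatzBody hh hp hz hq c hcheck.1 hcheck.2

/-- Hence also no germ-level datum, whatever the tables and directions. [folklore] -/
theorem not_localDatumZP_of_pointCheckP {S : ℕ → ℕ → QMvPoly} {M : ℕ → ℕ → Bool} {v : ℕ → E} {hyps pins : List QMvPoly} {zs : List ℕ}
    {nonneg : List QMvPoly} {c : PsatzLeaf} (hcheck : pointCheckP n hyps pins zs nonneg c = true) :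
    ¬ LocalDatumZP (E := E) n S M v hyps pins zs nonneg :=
  fun h => not_pointDatum_of_pointCheckP hcheck h.pointDatum

/-! ### Self-tests (`decide +kernel`)

Two letters `X₀ = a`, `X₁ = b`.  The set `{a + b² = 0, a − 1 ≥ 0}` is empty: `1 + b² + 1·(a − 1) = 1·(a + b²)`, i.e. pins `[]` (so `pins^(2e) = 1`),
`σ₀ = b²`, `σ₁ = 1` on the constraint of index `0`, ideal part `1 · law₀`. -/

/-- The micro-certificate of self-test (1). [folklore] -/
def exampleLeaf : PsatzLeaf :=
  { steps := [], comb := [(QMvPoly.const 1, 0)], e := [], sos0 := [(1, QMvPoly.var 2 1)], sosG := [([(1, QMvPoly.const 1)], [0])] }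

/-- Self-test (1): the point-level check passes (`decide +kernel`), hence the set is empty. [folklore] -/
theorem example_pointCheckP :
    pointCheckP 2 [QMvPoly.var 2 0 ++ QMvPoly.mul (QMvPoly.var 2 1) (QMvPoly.var 2 1)] [] []
      [QMvPoly.var 2 0 ++ QMvPoly.const (-1)] exampleLeaf = true := by
  decide +kernel

/-- Self-test (1), by name: no real `(a, b)` with `a + b² = 0` and `a ≥ 1`. [folklore] -/
theorem example_empty :
    ¬ PointDatum 2 [QMvPoly.var 2 0 ++ QMvPoly.mul (QMvPoly.var 2 1) (QMvPoly.var 2 1)] [] []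
      [QMvPoly.var 2 0 ++ QMvPoly.const (-1)] :=
  not_pointDatum_of_pointCheckP example_pointCheckP

/-- Self-test (2), GERM level (`decide +kernel`), on the micro-example of `…JetCertDefs` (letters `u, u′`, direction `0` with table `u ↦ u′`,
`u′ ↦ u`, hypothesis law `u′ − 2u = 0`; two derivation steps produce the law `u` with index `2`): with the sign constraint `u − 1 ≥ 0` at the base
point the datum is refuted by `1 + 1·(u − 1) = 1·law₂`. [folklore] -/
theorem example_leafCheckZP :
    leafCheckZP 2 exampleTable (fun j a => decide (j = 0) && decide (a < 2)) [QMvPoly.var 2 1 ++ QMvPoly.smul (-2) (QMvPoly.var 2 0)] [] []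
      [QMvPoly.var 2 0 ++ QMvPoly.const (-1)]
      { steps := [[(QMvPoly.const 1, 0, [0])], [(QMvPoly.const (-1/3), 1, []), (QMvPoly.const (-2/3), 0, [])]],
        comb := [(QMvPoly.const 1, 2)], e := [], sos0 := [], sosG := [([(1, QMvPoly.const 1)], [0])] } = true := by
  decide +kernel

end Summit.NavierStokesRegularity.NavierStokesRegularity.Theorems.PoloidalWindowDoorLrcModEntireJetCertPsatz

end
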